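import Literature.AlgebraicGeometry.Modules.PullbackContract
import Literature.AlgebraicGeometry.Modules.PullbackAffineChart
import Literature.AlgebraicGeometry.Modules.DetClassOfIso
import HarnessLib

/-!
# Brick (C): global dual sections of a pulled-back module — `Γ(f^*(E^∨), Y') ≃ Hom(f^*E|_⊤, 𝒪_{Y'}|_⊤)`, naturally in `f`

M13 PHASE A (director g8 s131; HOME-only under `B-plan/m13-glue/`, books 0, NOTHING filed) — node N1, generic brick (C)
of B-p01 (g11) 11:19:23Z («`dualSectionsEquiv`»; consumer: the dual side `DualReprChart` / `DualSecMap` of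
`N1c-Translation.v4.B-p01g11.lean` §6 and the (1b) producer B-p10 (g8) on `Modules.dual 𝓕`), B-typ03 (g12), B-plan1 (g11) R101.
Layer `Literature/AlgebraicGeometry/Modules`, namespace `Literature.AlgebraicGeometry.Modules`; would-be tree home
`Modules/PullbackDualSections.lean`. THEOREMS + three non-Prop definitions `isoSectionsLinearEquiv`, `dualSectionsEquiv'`, `dualSectionsEquiv` (no socket, no named fact, no instance, no `sorry`).

For a morphism of schemes `f : Y' ⟶ Y` and an `𝒪_Y`-module `E` (finite locally free, e.g. of rank one), the tree has the
base-change isomorphism of the dual ★ `pullbackDualIso f hE : f^*(E^∨) ≅ (f^*E)^∨` (`Modules/PullbackDual`,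
`= sheafHomPullbackComparison f E 𝒪_Y ≫ 𝓗om(f^*E, u_f)`, `u_f : f^*𝒪_Y ⟶ 𝒪_{Y'}` the transpose of the algebra unit) and the
definitional identification ★ `sheafHomSectionsEquiv : Γ(𝓗om(A, B), U) = (A|_U ⟶ B|_U)`. This file packages and COMPUTES it:

* §0 `isoSectionsLinearEquiv e U : Γ(M, U) ≃ₗ[Γ(X, U)] Γ(N, U)` — sections of an isomorphism of `𝒪_X`-modules (plumbing);
* §1 **`dualSectionsEquiv' f hE`** ∕ **`dualSectionsEquiv f (hE : HasRank E 1)`** :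
  `Γ(f^*(E^∨), ⊤) ≃ₗ[Γ(Y', ⊤)] ((f^*E)|_⊤ ⟶ 𝒪_{Y'}|_⊤)` — global sections of `pullbackDualIso`, read as morphisms of the
  restrictions (`dualSectionsEquiv'_apply`: it IS `s ↦ (pullbackDualIso f hE).hom.app ⊤ s`);
* §2 **`app_pullbackDualComparison_unitSection`** — its value on a pulled-back dual section: for a local
  `μ : E|_U ⟶ 𝒪_Y|_U`, `c_f(η_f(μ)) = f^*μ ≫ u_f|_{f⁻¹U}` (★ `app_sheafHomPullbackComparison_unitSection` + ★ `sheafHomMap_app_apply`);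
* §3 **`pullbackHomOver_comp_eq`** — pseudofunctoriality of `μ ↦ f^*μ` on LOCAL morphisms:
  `(g ≫ f)^*μ = pullbackComp⁻¹| ≫ g^*(f^*μ) ≫ pullbackComp|` (★ `hom_ext_of_appLE_unitSection` for `g ≫ f`,
  ★ `pullbackComp_{hom,inv}_app_unitSection`), and `u_{g ≫ f}` versus `g^*(u_f) ≫ u_g`;
* §4 **`pullback_map_pullbackDualComparison_comp`** — NATURALITY IN `f` (the cocycle of the dual comparison under
  composition, Hartshorne II Ex. 5.1 (d) ∕ Stacks 01CM functoriality): for `g : Y'' ⟶ Y'`,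
  `g^*(c_f) ≫ c_g = pullbackComp| ≫ c_{g ≫ f} ≫ 𝓗om(pullbackComp|, 𝒪)` as morphisms `g^*f^*(E^∨) ⟶ (g^*f^*E)^∨`
  (a two-level extensionality «morphisms out of `g^*f^*N` agree iff they agree on all `η_g(η_f(n))`» + §2 + §3), its
  `pullbackCongr` companion, and the SECTIONS FORM **`dualSectionsEquiv_naturality`** in the currency of the consumer
  (`unitSection` + `pullbackComp ≪≫ pullbackCongr` on the left = «`H0map` of `E^∨`»; `unitSection` + `pullbackDualIso g` +
  `sheafHomMapLeft (…)⁻¹` on the right = B-p01's `DualSecMap`), valid for ALL global sections `s` of `f^*(E^∨)`.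

HC_CM is proved only modulo the 7 printed citations until rung 0 closes.

## References

* R. Hartshorne, *Algebraic Geometry*, GTM 52 (1977), II Ex. 5.1 (b), (d); II.5 p. 110 (`f^* ⊣ f_*`). [Hartshorne1977]
* U. Görtz, T. Wedhorn, *Algebraic Geometry I: Schemes*, 2nd ed. (2020), (7.8.3) and Exercise 7.20 (a). [GortzWedhorn2020]
* The Stacks Project, Tag 01CM (internal Hom, functoriality), Tag 01AK (`f^*𝒪_Y = 𝒪_X`). [StacksProject]
* D. Mumford, *Abelian Varieties* (1970), §5 Cor. 2 (p. 47), §10 (p. 89) (the consumer: `H⁰(X_B, L_B⁻¹)`). [MumfordAV1970]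
-/

noncomputable section

-- `TopCat.Presheaf`/`Scheme.Modules` are not reducible (as in Mathlib's `AlgebraicGeometry/Modules/Sheaf.lean` and ★ `Modules/PullbackDual`).
set_option backward.isDefEq.respectTransparency false

open CategoryTheory AlgebraicGeometry Opposite TopologicalSpace

universe u

namespace Literature.AlgebraicGeometry.Modules

open Literature.AlgebraicGeometry.Motives

/-! ## §0 Sections of an isomorphism of modules -/

section IsoSections

variable {X : Scheme.{u}} {M N : X.Modules}

/-- Sections over `U` of an isomorphism `e : M ≅ N` of `𝒪_X`-modules: a `Γ(X, U)`-linear equivalence `Γ(M, U) ≃ Γ(N, U)`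
(non-Prop plumbing). [folklore] -/
def isoSectionsLinearEquiv (e : M ≅ N) (U : X.Opens) : Γ(M, U) ≃ₗ[Γ(X, U)] Γ(N, U) where
  toFun := e.hom.app U
  invFun := e.inv.app U
  map_add' x y := map_add _ x y
  map_smul' r x := Scheme.Modules.Hom.app_smul e.hom r x
  left_inv x := by
    have h := congrArg (fun φ => (Scheme.Modules.Hom.app φ U) x) e.hom_inv_id
    simpa only [Scheme.Modules.Hom.comp_app, Scheme.Modules.Hom.id_app, CategoryTheory.comp_apply,
      CategoryTheory.id_apply] using h
  right_inv x := by
    have h := congrArg (fun φ => (Scheme.Modules.Hom.app φ U) x) e.inv_hom_id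
    simpa only [Scheme.Modules.Hom.comp_app, Scheme.Modules.Hom.id_app, CategoryTheory.comp_apply,
      CategoryTheory.id_apply] using h

/-- `isoSectionsLinearEquiv e U` is `e.hom.app U`. [folklore] [cite: Hartshorne1977, II Ex. 5.1 (b)] -/
@[simp]
theorem isoSectionsLinearEquiv_apply (e : M ≅ N) (U : X.Opens) (x : Γ(M, U)) :
    isoSectionsLinearEquiv e U x = e.hom.app U x := rfl

/-- Its inverse is `e.inv.app U`. [folklore] [cite: Hartshorne1977, II Ex. 5.1 (b)] -/
@[simp]
theorem isoSectionsLinearEquiv_symm_apply (e : M ≅ N) (U : X.Opens) (y : Γ(N, U)) :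
    (isoSectionsLinearEquiv e U).symm y = e.inv.app U y := rfl

end IsoSections

/-! ## §1 The equivalence `Γ(f^*(E^∨), ⊤) ≃ₗ Hom(f^*E|_⊤, 𝒪|_⊤)` -/

section DualSections

variable {Y' Y : Scheme.{u}} (f : Y' ⟶ Y) {E : Y.Modules}

/-- **Brick (C), finite-locally-free form**: the global sections of `f^*(E^∨)` are, `Γ(Y', 𝒪)`-linearly, the morphisms
`(f^*E)|_⊤ ⟶ 𝒪_{Y'}|_⊤` — global sections of ★ `pullbackDualIso f hE : f^*(E^∨) ≅ (f^*E)^∨`, sections of `𝓗om` being morphisms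
of the restrictions (★ `sheafHomSectionsEquiv`, definitional) (non-Prop plumbing). [cite: Hartshorne1977, II Ex. 5.1 (b) and (d)] -/
def dualSectionsEquiv' (hE : IsFiniteLocallyFree E) :
    Γ((Scheme.Modules.pullback f).obj (dual E), (⊤ : Y'.Opens)) ≃ₗ[Γ(Y', (⊤ : Y'.Opens))]
      (((Scheme.Modules.pullback f).obj E).over (⊤ : Y'.Opens) ⟶ (unitModule Y').over (⊤ : Y'.Opens)) :=
  isoSectionsLinearEquiv (pullbackDualIso f hE) ⊤

/-- `dualSectionsEquiv'` is `s ↦ (pullbackDualIso f hE).hom.app ⊤ s` read as a morphism `(f^*E)|_⊤ ⟶ 𝒪|_⊤`. [folklore] [cite: Hartshorne1977, II Ex. 5.1 (b) and (d)] -/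
theorem dualSectionsEquiv'_apply (hE : IsFiniteLocallyFree E) (s : Γ((Scheme.Modules.pullback f).obj (dual E), (⊤ : Y'.Opens))) :
    dualSectionsEquiv' f hE s = (pullbackDualIso f hE).hom.app ⊤ s := rfl

/-- The inverse: `μ ↦ (pullbackDualIso f hE).inv.app ⊤ μ`. [folklore] [cite: Hartshorne1977, II Ex. 5.1 (b) and (d)] -/
theorem dualSectionsEquiv'_symm_apply (hE : IsFiniteLocallyFree E)
    (μ : ((Scheme.Modules.pullback f).obj E).over (⊤ : Y'.Opens) ⟶ (unitModule Y').over (⊤ : Y'.Opens)) :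
    (dualSectionsEquiv' f hE).symm μ = (pullbackDualIso f hE).inv.app ⊤ μ := rfl

/-- **Brick (C)** (B-p01 (g11) 11:19:23Z): for `E` of rank one, `Γ(f^*(E^∨), ⊤) ≃ₗ[Γ(Y', ⊤)] ((f^*E)|_⊤ ⟶ 𝒪_{Y'}|_⊤)`
(non-Prop plumbing; `= dualSectionsEquiv' f hE.isFiniteLocallyFree'`). [cite: Hartshorne1977, II Ex. 5.1 (b) and (d)]
[cite: MumfordAV1970, §10 (p. 89)] -/
def dualSectionsEquiv (hE : HasRank E 1) :
    Γ((Scheme.Modules.pullback f).obj (dual E), (⊤ : Y'.Opens)) ≃ₗ[Γ(Y', (⊤ : Y'.Opens))]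
      (((Scheme.Modules.pullback f).obj E).over (⊤ : Y'.Opens) ⟶ (unitModule Y').over (⊤ : Y'.Opens)) :=
  dualSectionsEquiv' f (HasRank.isFiniteLocallyFree' hE)

/-- `dualSectionsEquiv f hE s = (pullbackDualIso f _).hom.app ⊤ s`. [folklore] [cite: Hartshorne1977, II Ex. 5.1 (b) and (d)] -/
theorem dualSectionsEquiv_apply (hE : HasRank E 1) (s : Γ((Scheme.Modules.pullback f).obj (dual E), (⊤ : Y'.Opens))) :
    dualSectionsEquiv f hE s = (pullbackDualIso f (HasRank.isFiniteLocallyFree' hE)).hom.app ⊤ s := rfl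

/-! ## §2 The value of the dual comparison on pulled-back dual sections -/

/-- **`c_f(η_f(μ)) = f^*μ ≫ u_f|`**: the dual comparison `c_f : f^*(E^∨) ⟶ (f^*E)^∨` sends the pulled-back section `η_f(μ)` of a
local dual section `μ : E|_U ⟶ 𝒪_Y|_U` to `f^*μ : (f^*E)|_{f⁻¹U} ⟶ (f^*𝒪_Y)|_{f⁻¹U}` (★ `pullbackHomOver`) followed by
`u_f : f^*𝒪_Y ⟶ 𝒪_{Y'}` restricted. [cite: GortzWedhorn2020, (7.8.3) and Exercise 7.20 (a)] [cite: Hartshorne1977, II Ex. 5.1 (d)] -/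
theorem app_pullbackDualComparison_unitSection (E : Y.Modules) (U : Y.Opens) (μ : E.over U ⟶ (unitModule Y).over U) :
    (pullbackDualComparison f E).app (f ⁻¹ᵁ U) (unitSection f (dual E) U μ) =
      pullbackHomOver f μ ≫ (SheafOfModules.overFunctor _ (f ⁻¹ᵁ U)).map (pullbackUnitComparison f) := by
  rw [pullbackDualComparison, Scheme.Modules.Hom.comp_app]
  change (sheafHomMap ((Scheme.Modules.pullback f).obj E) (pullbackUnitComparison f)).app (f ⁻¹ᵁ U)
      ((sheafHomPullbackComparison f E (unitModule Y)).app (f ⁻¹ᵁ U) (unitSection f (sheafHom E (unitModule Y)) U μ)) = _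
  rw [app_sheafHomPullbackComparison_unitSection, sheafHomMap_app_apply]

/-- The same for the isomorphism `pullbackDualIso`. [cite: Hartshorne1977, II Ex. 5.1 (b) and (d)] -/
theorem pullbackDualIso_hom_app_unitSection (hE : IsFiniteLocallyFree E) (U : Y.Opens) (μ : E.over U ⟶ (unitModule Y).over U) :
    (pullbackDualIso f hE).hom.app (f ⁻¹ᵁ U) (unitSection f (dual E) U μ) =
      pullbackHomOver f μ ≫ (SheafOfModules.overFunctor _ (f ⁻¹ᵁ U)).map (pullbackUnitComparison f) := by
  rw [pullbackDualIso_hom]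
  exact app_pullbackDualComparison_unitSection f E U μ

/-- **The equivalence on a pulled-back GLOBAL dual section**: `dualSectionsEquiv' f hE (η_f(μ)) = f^*μ ≫ u_f|_⊤` for
`μ : E|_⊤ ⟶ 𝒪_Y|_⊤`. [cite: Hartshorne1977, II Ex. 5.1 (d)] -/
theorem dualSectionsEquiv'_unitSection (hE : IsFiniteLocallyFree E) (μ : E.over (⊤ : Y.Opens) ⟶ (unitModule Y).over (⊤ : Y.Opens)) :
    dualSectionsEquiv' f hE (unitSection f (dual E) ⊤ μ) =
      pullbackHomOver f μ ≫ (SheafOfModules.overFunctor _ (f ⁻¹ᵁ ⊤)).map (pullbackUnitComparison f) :=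
  pullbackDualIso_hom_app_unitSection f hE ⊤ μ

/-! ## §2′ Brick (N), generic form: the evaluation pairing commutes with base change -/

/-- **Brick (N), generic form** (B-p01 (g11) socket `brickN`): for a local dual section `μ : E|_U ⟶ 𝒪_Y|_U` and a section
`σ ∈ Γ(E, W)`, `W ≤ U`, the pulled-back dual section evaluated on the pulled-back section is the pulled-back function:
`(c_f η_f(μ))(η_f(σ)) = f♯(μ(σ))` (§2 + ★ `appLE_pullbackHomOver_unitSection` + ★ `app_pullbackUnitComparison_unitSection`).
[cite: Hartshorne1977, II Ex. 5.1 (d)] -/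
theorem appLE_pullbackDualComparison_unitSection_unitSection (E : Y.Modules) {U W : Y.Opens} (k : W ⟶ U)
    (μ : E.over U ⟶ (unitModule Y).over U) (σ : Γ(E, W)) :
    appLE ((pullbackDualComparison f E).app (f ⁻¹ᵁ U) (unitSection f (dual E) U μ) :
        ((Scheme.Modules.pullback f).obj E).over (f ⁻¹ᵁ U) ⟶ (unitModule Y').over (f ⁻¹ᵁ U))
      ((Opens.map f.base).map k) (unitSection f E W σ) =
      (f.app W (appLE μ k σ : Γ(unitModule Y, W)) : Γ(unitModule Y', f ⁻¹ᵁ W)) := by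
  rw [app_pullbackDualComparison_unitSection, appLE_comp, appLE_over_map, appLE_pullbackHomOver_unitSection]
  exact app_pullbackUnitComparison_unitSection f W (appLE μ k σ)

/-- **Brick (N) at `⊤` through the isomorphism** (the shape of B-p01's `evalPair`/`DualSecMap`/`H0map` before the `FBIso`
cancellation): `appLE ((pullbackDualIso f hE).hom.app ⊤ (η_f μ)) (𝟙 ⊤) (η_f σ) = f♯_⊤ (appLE μ (𝟙 ⊤) σ)`.
[cite: Hartshorne1977, II Ex. 5.1 (d)] [cite: MumfordAV1970, §10 (p. 89)] -/
theorem appLE_pullbackDualIso_hom_app_unitSection (hE : IsFiniteLocallyFree E)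
    (μ : E.over (⊤ : Y.Opens) ⟶ (unitModule Y).over (⊤ : Y.Opens)) (σ : Γ(E, (⊤ : Y.Opens))) :
    appLE ((pullbackDualIso f hE).hom.app ⊤ (unitSection f (dual E) ⊤ μ) :
        ((Scheme.Modules.pullback f).obj E).over (f ⁻¹ᵁ ⊤) ⟶ (unitModule Y').over (f ⁻¹ᵁ ⊤))
      (𝟙 _) (unitSection f E ⊤ σ) =
      (f.app ⊤ (appLE μ (𝟙 ⊤) σ : Γ(unitModule Y, (⊤ : Y.Opens))) : Γ(unitModule Y', f ⁻¹ᵁ ⊤)) := by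
  rw [pullbackDualIso_hom]
  exact (appLE_congr_hom _ _ _ _).trans (appLE_pullbackDualComparison_unitSection_unitSection f E (𝟙 ⊤) μ σ)

end DualSections

/-! ## §3⁰ Extensionality on pulled-back sections (one and two levels) -/

section Ext

variable {X' X Y : Scheme.{u}} (g : X' ⟶ X) (f : X ⟶ Y) {M : Y.Modules}

/-- The transpose `M ⟶ f_*N` of `φ : f^*M ⟶ N` has sections `m ↦ φ(η_f(m))`. [cite: Hartshorne1977, II.5 (p. 110)] -/
theorem pullbackObj_homEquiv_app' {N : X.Modules} (φ : (Scheme.Modules.pullback f).obj M ⟶ N) (V : Y.Opens) (m : Γ(M, V)) :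
    ((Scheme.Modules.pullbackPushforwardAdjunction f).homEquiv _ _ φ).app V m =
      φ.app (f ⁻¹ᵁ V) (unitSection f M V m) := by
  rw [Adjunction.homEquiv_unit]
  rfl

/-- **Two morphisms out of `f^*M` that agree on all pulled-back sections `η_f(m)` are equal** (their transposes agree;
the statement of ★ `HodgeTheory/CotangentSheafPullbackHom.pullbackObj_hom_ext_unitSection`, re-derived here to keep the
import cone inside `Modules/`). [cite: Hartshorne1977, II.5 (p. 110)] -/
theorem pullbackObj_hom_ext_unitSection' {N : X.Modules} (φ₁ φ₂ : (Scheme.Modules.pullback f).obj M ⟶ N)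
    (h : ∀ (V : Y.Opens) (m : Γ(M, V)),
      φ₁.app (f ⁻¹ᵁ V) (unitSection f M V m) = φ₂.app (f ⁻¹ᵁ V) (unitSection f M V m)) : φ₁ = φ₂ := by
  apply ((Scheme.Modules.pullbackPushforwardAdjunction f).homEquiv _ _).injective
  refine Scheme.Modules.hom_ext _ _ fun V => ?_
  ext m
  rw [pullbackObj_homEquiv_app', pullbackObj_homEquiv_app']
  exact h V m

/-- **Two levels: morphisms out of `g^*(f^*M)` that agree on all `η_g(η_f(m))` are equal** (transpose twice: `M ⟶ f_*g_*N`).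
[cite: Hartshorne1977, II.5 (p. 110)] -/
theorem pullback_pullback_hom_ext_unitSection {N : X'.Modules}
    (φ₁ φ₂ : (Scheme.Modules.pullback g).obj ((Scheme.Modules.pullback f).obj M) ⟶ N)
    (h : ∀ (V : Y.Opens) (m : Γ(M, V)),
      φ₁.app (g ⁻¹ᵁ (f ⁻¹ᵁ V)) (unitSection g _ (f ⁻¹ᵁ V) (unitSection f M V m)) =
        φ₂.app (g ⁻¹ᵁ (f ⁻¹ᵁ V)) (unitSection g _ (f ⁻¹ᵁ V) (unitSection f M V m))) : φ₁ = φ₂ := by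
  apply ((Scheme.Modules.pullbackPushforwardAdjunction g).homEquiv _ _).injective
  refine pullbackObj_hom_ext_unitSection' f _ _ fun V m => ?_
  rw [pullbackObj_homEquiv_app', pullbackObj_homEquiv_app']
  exact h V m

end Ext

/-! ## §3 Pseudofunctoriality of `μ ↦ f^*μ` on local morphisms, and `u_{g ≫ f}` -/

section Comp

variable {Y'' Y' Y : Scheme.{u}} (g : Y'' ⟶ Y') (f : Y' ⟶ Y) {A M : Y.Modules} {U : Y.Opens}

/-- **`(g ≫ f)^*μ = pullbackComp⁻¹| ≫ g^*(f^*μ) ≫ pullbackComp|`** for a LOCAL morphism `μ : A|_U ⟶ M|_U` (Mathlib's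
`Scheme.Modules.pullbackComp g f : f^* ⋙ g^* ≅ (g ≫ f)^*`, restricted to `(g ≫ f)⁻¹U = g⁻¹(f⁻¹U)`): both sides send `η_{g ≫ f}(b)`
to `η_{g ≫ f}(μ(b))` (★ `hom_ext_of_appLE_unitSection`, ★ `pullbackComp_{inv,hom}_app_unitSection`).
[cite: GortzWedhorn2020, (7.8.3) and Exercise 7.20 (a)] [cite: StacksProject, Tag 01CM] -/
theorem pullbackHomOver_comp_eq (μ : A.over U ⟶ M.over U) :
    (pullbackHomOver (g ≫ f) μ :
        ((Scheme.Modules.pullback (g ≫ f)).obj A).over (g ⁻¹ᵁ f ⁻¹ᵁ U) ⟶ ((Scheme.Modules.pullback (g ≫ f)).obj M).over (g ⁻¹ᵁ f ⁻¹ᵁ U)) =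
      (SheafOfModules.overFunctor _ (g ⁻¹ᵁ f ⁻¹ᵁ U)).map ((Scheme.Modules.pullbackComp g f).inv.app A) ≫
        pullbackHomOver g (pullbackHomOver f μ) ≫
          (SheafOfModules.overFunctor _ (g ⁻¹ᵁ f ⁻¹ᵁ U)).map ((Scheme.Modules.pullbackComp g f).hom.app M) := by
  refine hom_ext_of_appLE_unitSection (g ≫ f) fun W k b => ?_
  rw [appLE_pullbackHomOver_unitSection]
  -- read the right-hand side over the opens `g⁻¹(f⁻¹W) ≤ g⁻¹(f⁻¹U)` (the same opens as `(g ≫ f)⁻¹W ≤ (g ≫ f)⁻¹U`, definitionally)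
  show _ = appLE ((SheafOfModules.overFunctor _ (g ⁻¹ᵁ f ⁻¹ᵁ U)).map ((Scheme.Modules.pullbackComp g f).inv.app A) ≫
      pullbackHomOver g (pullbackHomOver f μ) ≫
        (SheafOfModules.overFunctor _ (g ⁻¹ᵁ f ⁻¹ᵁ U)).map ((Scheme.Modules.pullbackComp g f).hom.app M))
    ((Opens.map g.base).map ((Opens.map f.base).map k)) (unitSection (g ≫ f) A W b)
  rw [appLE_comp, appLE_comp, appLE_over_map, appLE_over_map, pullbackComp_inv_app_unitSection,
    appLE_pullbackHomOver_unitSection, appLE_pullbackHomOver_unitSection]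
  exact (pullbackComp_hom_app_unitSection f M g W (appLE μ k b)).symm

/-- **`u_{g ≫ f} = pullbackComp⁻¹ ≫ g^*(u_f) ≫ u_g`** (`(g ≫ f)^*𝒪_Y ⟶ 𝒪_{Y''}`): both sides send `η_{g ≫ f}(r)` to `(g ≫ f)♯(r)`
(★ `app_pullbackUnitComparison_unitSection`). [cite: StacksProject, Tag 01AK] -/
theorem pullbackUnitComparison_comp :
    pullbackUnitComparison (g ≫ f) =
      (Scheme.Modules.pullbackComp g f).inv.app (unitModule Y) ≫
        (Scheme.Modules.pullback g).map (pullbackUnitComparison f) ≫ pullbackUnitComparison g := by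
  refine pullbackObj_hom_ext_unitSection' (g ≫ f) _ _ fun V r => ?_
  rw [app_pullbackUnitComparison_unitSection, Scheme.Modules.Hom.comp_app, Scheme.Modules.Hom.comp_app,
    ConcreteCategory.comp_apply, ConcreteCategory.comp_apply]
  have h1 : ((Scheme.Modules.pullbackComp g f).inv.app (unitModule Y)).app ((g ≫ f) ⁻¹ᵁ V) (unitSection (g ≫ f) (unitModule Y) V r) =
      unitSection g ((Scheme.Modules.pullback f).obj (unitModule Y)) (f ⁻¹ᵁ V) (unitSection f (unitModule Y) V r) :=
    pullbackComp_inv_app_unitSection f (unitModule Y) g V r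
  have h2 : ((Scheme.Modules.pullback g).map (pullbackUnitComparison f)).app ((g ≫ f) ⁻¹ᵁ V)
        (unitSection g ((Scheme.Modules.pullback f).obj (unitModule Y)) (f ⁻¹ᵁ V) (unitSection f (unitModule Y) V r)) =
      unitSection g (unitModule Y') (f ⁻¹ᵁ V) (f.app V r) := by
    rw [← app_pullbackUnitComparison_unitSection f V r]
    exact pullback_map_app_unitSection g (pullbackUnitComparison f) (f ⁻¹ᵁ V) _
  have h3 : (pullbackUnitComparison g).app ((g ≫ f) ⁻¹ᵁ V) (unitSection g (unitModule Y') (f ⁻¹ᵁ V) (f.app V r)) =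
      g.app (f ⁻¹ᵁ V) (f.app V r) :=
    app_pullbackUnitComparison_unitSection g (f ⁻¹ᵁ V) (f.app V r)
  rw [h1]
  exact (((congrArg (fun t => (pullbackUnitComparison g).app ((g ≫ f) ⁻¹ᵁ V) t) h2).trans h3).trans rfl).symm

/-- **§2 for a composite, read over `g⁻¹(f⁻¹V)`**: `c_{g ≫ f}(η_{g ≫ f}(μ))`, as a morphism of the restrictions to the open
`g⁻¹(f⁻¹V)` (`= (g ≫ f)⁻¹V`), is `pullbackComp⁻¹| ≫ g^*(f^*μ) ≫ pullbackComp| ≫ u_{g ≫ f}|` (§2, §3 and ★ `hom_ext_of_appLE`).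
[cite: Hartshorne1977, II Ex. 5.1 (d)] [cite: StacksProject, Tag 01CM] -/
theorem app_pullbackDualComparison_comp_unitSection (E : Y.Modules) (V : Y.Opens)
    (μ : E.over V ⟶ (unitModule Y).over V) :
    (pullbackDualComparison (g ≫ f) E).app (g ⁻¹ᵁ (f ⁻¹ᵁ V)) (unitSection (g ≫ f) (dual E) V μ) =
      ((SheafOfModules.overFunctor _ (g ⁻¹ᵁ f ⁻¹ᵁ V)).map ((Scheme.Modules.pullbackComp g f).inv.app E) ≫
        pullbackHomOver g (pullbackHomOver f μ) ≫
          (SheafOfModules.overFunctor _ (g ⁻¹ᵁ f ⁻¹ᵁ V)).map ((Scheme.Modules.pullbackComp g f).hom.app (unitModule Y))) ≫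
        (SheafOfModules.overFunctor _ (g ⁻¹ᵁ f ⁻¹ᵁ V)).map (pullbackUnitComparison (g ≫ f)) := by
  refine hom_ext_of_appLE fun W' k' x => ?_
  rw [appLE_comp, appLE_over_map]
  -- the only change of spelling of the open `(g ≫ f)⁻¹V = g⁻¹(f⁻¹V)`: the same value read over either (definitional)
  have h0 : appLE ((pullbackDualComparison (g ≫ f) E).app (g ⁻¹ᵁ (f ⁻¹ᵁ V)) (unitSection (g ≫ f) (dual E) V μ) :
        ((Scheme.Modules.pullback (g ≫ f)).obj E).over (g ⁻¹ᵁ f ⁻¹ᵁ V) ⟶ (unitModule Y'').over (g ⁻¹ᵁ f ⁻¹ᵁ V)) k' x =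
      appLE ((pullbackDualComparison (g ≫ f) E).app ((g ≫ f) ⁻¹ᵁ V) (unitSection (g ≫ f) (dual E) V μ) :
        ((Scheme.Modules.pullback (g ≫ f)).obj E).over ((g ≫ f) ⁻¹ᵁ V) ⟶ (unitModule Y'').over ((g ≫ f) ⁻¹ᵁ V)) k' x := rfl
  rw [h0, app_pullbackDualComparison_unitSection, appLE_comp, appLE_over_map]
  exact congrArg (fun z => (pullbackUnitComparison (g ≫ f)).app W' (appLE z k' x)) (pullbackHomOver_comp_eq g f μ)

end Comp

/-! ## §4 Naturality in `f`: the cocycle of the dual comparison under composition -/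

section Cocycle

variable {Y'' Y' Y : Scheme.{u}} (g : Y'' ⟶ Y') (f : Y' ⟶ Y) (E : Y.Modules)

/-- **The dual comparison is a cocycle under composition** (naturality of brick (C) in `f`): for `g : Y'' ⟶ Y'`, `f : Y' ⟶ Y`,
`g^*(c_f) ≫ c_g = pullbackComp| ≫ c_{g ≫ f} ≫ 𝓗om(pullbackComp|, 𝒪_{Y''})` as morphisms `g^*f^*(E^∨) ⟶ (g^*f^*E)^∨`
(both send `η_g(η_f(μ))` to `g^*(f^*μ) ≫ g^*(u_f)| ≫ u_g|`; §3⁰ two-level extensionality). [cite: Hartshorne1977, II Ex. 5.1 (d)]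
[cite: StacksProject, Tag 01CM] -/
theorem pullback_map_pullbackDualComparison_comp :
    (Scheme.Modules.pullback g).map (pullbackDualComparison f E) ≫
        pullbackDualComparison g ((Scheme.Modules.pullback f).obj E) =
      (Scheme.Modules.pullbackComp g f).hom.app (dual E) ≫ pullbackDualComparison (g ≫ f) E ≫
        sheafHomMapLeft ((Scheme.Modules.pullbackComp g f).hom.app E) (unitModule Y'') := by
  refine pullback_pullback_hom_ext_unitSection g f _ _ fun V μ => ?_
  simp only [Scheme.Modules.Hom.comp_app, ConcreteCategory.comp_apply]
  rw [pullback_map_app_unitSection, app_pullbackDualComparison_unitSection f E V μ,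
    app_pullbackDualComparison_unitSection g ((Scheme.Modules.pullback f).obj E) (f ⁻¹ᵁ V), pullbackHomOver_comp,
    pullbackHomOver_over_map]
  have h1 : ((Scheme.Modules.pullbackComp g f).hom.app (dual E)).app (g ⁻¹ᵁ (f ⁻¹ᵁ V))
      (unitSection g ((Scheme.Modules.pullback f).obj (dual E)) (f ⁻¹ᵁ V) (unitSection f (dual E) V μ)) =
      unitSection (g ≫ f) (dual E) V μ :=
    pullbackComp_hom_app_unitSection f (dual E) g V μ
  have h2 := congrArg (fun t => (sheafHomMapLeft ((Scheme.Modules.pullbackComp g f).hom.app E) (unitModule Y'')).app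
    (g ⁻¹ᵁ (f ⁻¹ᵁ V)) ((pullbackDualComparison (g ≫ f) E).app (g ⁻¹ᵁ (f ⁻¹ᵁ V)) t)) h1
  refine Eq.trans ?_ h2.symm
  rw [app_pullbackDualComparison_comp_unitSection, sheafHomMapLeft_app_apply, pullbackUnitComparison_comp g f]
  simp only [Functor.map_comp, Category.assoc]
  simp only [← Functor.map_comp, ← Functor.map_comp_assoc, Iso.hom_inv_id_app, Iso.hom_inv_id_app_assoc]
  simp only [CategoryTheory.Functor.map_id, Category.id_comp]

/-- **The `pullbackCongr` companion**: for equal morphisms `f₁ = f₂` the dual comparisons agree through Mathlib's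
`Scheme.Modules.pullbackCongr` (an `eqToIso`). [folklore] [cite: Hartshorne1977, II Ex. 5.1 (d)] [cite: StacksProject, Tag 01CM] -/
theorem pullbackCongr_hom_app_comp_pullbackDualComparison {f₁ f₂ : Y' ⟶ Y} (h : f₁ = f₂) :
    (Scheme.Modules.pullbackCongr h).hom.app (dual E) ≫ pullbackDualComparison f₂ E ≫
        sheafHomMapLeft ((Scheme.Modules.pullbackCongr h).hom.app E) (unitModule Y') =
      pullbackDualComparison f₁ E := by
  subst h
  simp [Scheme.Modules.pullbackCongr, sheafHomMapLeft_id]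

/-- The cocycle solved for `c_{g ≫ f}`: `c_{g ≫ f} = pullbackComp⁻¹| ≫ g^*(c_f) ≫ c_g ≫ 𝓗om(pullbackComp⁻¹|, 𝒪)`.
[cite: Hartshorne1977, II Ex. 5.1 (d)] -/
theorem pullbackDualComparison_comp :
    pullbackDualComparison (g ≫ f) E =
      (Scheme.Modules.pullbackComp g f).inv.app (dual E) ≫
        (Scheme.Modules.pullback g).map (pullbackDualComparison f E) ≫
          pullbackDualComparison g ((Scheme.Modules.pullback f).obj E) ≫
            sheafHomMapLeft ((Scheme.Modules.pullbackComp g f).inv.app E) (unitModule Y'') := by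
  rw [← Category.assoc ((Scheme.Modules.pullback g).map _), pullback_map_pullbackDualComparison_comp, Category.assoc,
    Category.assoc, ← sheafHomMapLeft_comp, ← NatTrans.comp_app, Iso.inv_hom_id, NatTrans.id_app, sheafHomMapLeft_id,
    Category.comp_id, Iso.inv_hom_id_app_assoc]

/-! ### The sections form (the currency of the consumer `N1c-Translation` §6: `H0map` of `E^∨` versus `DualSecMap`) -/

variable {E}

/-- **Naturality of brick (C) in `f`, on global sections, for a composite `g ≫ f`**: for EVERY global section `s` of `f^*(E^∨)`,
transporting `s` to `(g ≫ f)^*(E^∨)` (`η_g`, then `pullbackComp`) and reading it as a morphism `((g ≫ f)^*E)|_⊤ ⟶ 𝒪|_⊤` agrees with: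
read `s` as `(f^*E)|_⊤ ⟶ 𝒪|_⊤`, pull back (`η_g`, then `pullbackDualIso g`) and precompose with `pullbackComp⁻¹`.
[cite: Hartshorne1977, II Ex. 5.1 (d)] [cite: MumfordAV1970, §10 (p. 89)] -/
theorem dualSectionsEquiv'_naturality_comp (hE : IsFiniteLocallyFree E)
    (s : Γ((Scheme.Modules.pullback f).obj (dual E), (⊤ : Y'.Opens))) :
    dualSectionsEquiv' (g ≫ f) hE
        ((((Scheme.Modules.pullbackComp g f).app (dual E)).hom.app ⊤)
          (unitSection g ((Scheme.Modules.pullback f).obj (dual E)) ⊤ s)) =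
      ((sheafHomMapLeft ((Scheme.Modules.pullbackComp g f).app E).inv (unitModule Y'')).app ⊤)
        (((pullbackDualIso g (hE.pullback f)).hom.app ⊤)
          (unitSection g (dual ((Scheme.Modules.pullback f).obj E)) ⊤ (dualSectionsEquiv' f hE s))) := by
  rw [dualSectionsEquiv'_apply, dualSectionsEquiv'_apply, pullbackDualIso_hom, pullbackDualIso_hom, pullbackDualIso_hom,
    pullbackDualComparison_comp g f E]
  simp only [Scheme.Modules.Hom.comp_app, ConcreteCategory.comp_apply, Iso.app_hom, Iso.app_inv]
  -- `pullbackComp⁻¹(pullbackComp(η_g s)) = η_g s` and `g^*(c_f)(η_g s) = η_g(c_f s)`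
  have h1 : ((Scheme.Modules.pullbackComp g f).inv.app (dual E)).app ⊤
      (((Scheme.Modules.pullbackComp g f).hom.app (dual E)).app ⊤ (unitSection g ((Scheme.Modules.pullback f).obj (dual E)) ⊤ s)) =
      unitSection g ((Scheme.Modules.pullback f).obj (dual E)) ⊤ s := by
    rw [← ConcreteCategory.comp_apply, ← Scheme.Modules.Hom.comp_app, Iso.hom_inv_id_app, Scheme.Modules.Hom.id_app]
    rfl
  have h2 : ((Scheme.Modules.pullback g).map (pullbackDualComparison f E)).app ⊤
      (unitSection g ((Scheme.Modules.pullback f).obj (dual E)) ⊤ s) =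
      unitSection g (dual ((Scheme.Modules.pullback f).obj E)) ⊤ ((pullbackDualComparison f E).app ⊤ s) :=
    pullback_map_app_unitSection g (pullbackDualComparison f E) ⊤ s
  rw [h1]
  exact congrArg (fun t => (sheafHomMapLeft ((Scheme.Modules.pullbackComp g f).inv.app E) (unitModule Y'')).app ⊤
    ((pullbackDualComparison g ((Scheme.Modules.pullback f).obj E)).app ⊤ t)) h2

/-- **Naturality of brick (C) in `f`, on global sections, in the consumer's currency** (B-p01 (g11) `N1c-Translation` §6:
the transport `pullbackComp ≪≫ pullbackCongr h` is its `FBIso`, the left-hand side is «`H0map` of the module `E^∨`», the right-hand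
side is its `DualSecMap` applied to `dualSectionsEquiv f hE s`): for `h : g ≫ f = f'`, rank-one `E` and EVERY global section `s`
of `f^*(E^∨)`. [cite: Hartshorne1977, II Ex. 5.1 (d)] [cite: MumfordAV1970, §5 Cor. 2 (p. 47) and §10 (p. 89)] -/
theorem dualSectionsEquiv_naturality (hE : HasRank E 1) {f' : Y'' ⟶ Y} (h : g ≫ f = f')
    (s : Γ((Scheme.Modules.pullback f).obj (dual E), (⊤ : Y'.Opens))) :
    dualSectionsEquiv f' hE
        ((((Scheme.Modules.pullbackComp g f).app (dual E) ≪≫ (Scheme.Modules.pullbackCongr h).app (dual E)).hom.app ⊤)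
          (unitSection g ((Scheme.Modules.pullback f).obj (dual E)) ⊤ s)) =
      ((sheafHomMapLeft ((Scheme.Modules.pullbackComp g f).app E ≪≫ (Scheme.Modules.pullbackCongr h).app E).inv
          (unitModule Y'')).app ⊤)
        (((pullbackDualIso g (HasRank.isFiniteLocallyFree' (hasRank_pullback f hE))).hom.app ⊤)
          (unitSection g (dual ((Scheme.Modules.pullback f).obj E)) ⊤ (dualSectionsEquiv f hE s))) := by
  subst h
  have key := dualSectionsEquiv'_naturality_comp g f (HasRank.isFiniteLocallyFree' hE) s
  simpa [dualSectionsEquiv, Scheme.Modules.pullbackCongr] using key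

end Cocycle

end Literature.AlgebraicGeometry.Modules

end
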